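import Mathlib
import HarnessLib
import Summits.ValiantsHypothesis.ValiantsHypothesis.Theorems.KPlusLogSqLawMixedGaugeFamilyDownward

/-!
# Route «KPlusLogSqLaw», `WeakLifting` (stmt-ValiantsHypothesis-19561) — mixed-gauge series, NEXT SHAPE (several slow speeds, one fast speed):
# THE FAMILY DOWNWARD LAW WITH COORDINATEWISE EXPONENTS — non-positive-type kernel directions over all roots number at most `m`

HONEST FRAMING.  Helper file (hand leafhand-val-kpluslogsqlaw-1 g14, 2026-08-31; `--supports stmt-ValiantsHypothesis-19561 --as helper`,
zero crux / stub credit).  First half of the next shape of lift-p4 g26's GAP NOTE (ii) after the two-class law at every ratio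
(`…MixedGaugeTwoClassAllRatios`, p834386): the vertex gauge `M(x) = N + diag(x^{a₁}, …, x^{aₙ}) ⊕ (−x^b·1ₘ)` with SEVERAL slow speeds
`aᵢ < b` and ONE fast speed.  Its block two-point identity reads `Σᵢ (s'^{aᵢ} − s^{aᵢ}) wᵢwᵢ' = (s'^b − s^b)⟪q,q'⟫`, i.e. with nodes
`Y = s^b` and exponents `pᵢ = aᵢ/b ∈ (0,1)`: `⟪q,q'⟫ = Σᵢ L^{(pᵢ)}(Y,Y') wᵢwᵢ'` — a COORDINATEWISE family of Loewner kernels, each strictly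
positive definite (`MixedGauge.loewnerForm_pos`, p833028).  THIS FILE: the abstract FAMILY DOWNWARD LAW in that generality
(`family_down_card_le_coord`): distinct positive nodes `Y_t`, exponents `p : Fin n → (0,1)`, vectors `(wⱼ, qⱼ)` attached to nodes with the
coordinatewise two-point identities across distinct nodes, DOWNWARD ON THE SPAN at each node
(`Σᵢ pᵢ Y_t^{pᵢ−1} (Σ cⱼwⱼ(i))² ≤ ‖Σ cⱼqⱼ‖²`) and independent per node ⇒ `#J ≤ m`.  The single-exponent case is p833439's
`family_down_card_le`.  The inertia half of the next shape (one-sided jumps, refined window, end scales) is format bookkeeping over the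
landed kit; nothing of it is claimed here.  Nothing here is about `WeakLifting` / `TropicalB` in their windows, the registered stubs, the
doors, `MatrixDescartes` (18050) or VP ≠ VNP.  No `def`; axioms standard. [folklore linear algebra over Loewner kernels]
-/

set_option linter.dupNamespace false
set_option autoImplicit false

namespace Summit.ValiantsHypothesis.ValiantsHypothesis.Theorems.KPlusLogSqLaw

namespace MixedGauge

open MeasureTheory Set Filter Real Matrix Finset
open scoped Topology BigOperators
open Summit.ValiantsHypothesis.ValiantsHypothesis.Theorems.KPlusLogSqLaw.TowerGraft.TwoSidedThree.Loewner

variable {n m : ℕ}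

/-- **FAMILY DOWNWARD LAW with coordinatewise exponents.**  Distinct positive nodes `Y_t` (`t < T`), exponents `pᵢ ∈ (0,1)` (`i < n`), a finite
family `J` of vectors `(wⱼ, qⱼ) ∈ ℝⁿ × ℝᵐ` attached to nodes by `root`, with (i) across DIFFERENT nodes
`Σᵢ (Y_{t'}^{pᵢ} − Y_t^{pᵢ}) wⱼ(i) wⱼ'(i) = (Y_{t'} − Y_t)⟪qⱼ,qⱼ'⟫`, (ii) at each node DOWNWARD ON THE SPAN
`Σᵢ pᵢ Y_t^{pᵢ−1} (Σ_{j at t} cⱼwⱼ(i))² ≤ ‖Σ_{j at t} cⱼqⱼ‖²`, (iii) vanishing of all per-node aggregates forces `c = 0`.  Then `#J ≤ m`. [folklore] -/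
theorem family_down_card_le_coord {T : ℕ} {J : Type} [Fintype J] [DecidableEq J] (p : Fin n → ℝ) (hp : ∀ i, p i ∈ Set.Ioo (0:ℝ) 1)
    (Y : Fin T → ℝ) (hY : ∀ t, 0 < Y t) (hinj : Function.Injective Y) (root : J → Fin T)
    (w : J → (Fin n → ℝ)) (q : J → (Fin m → ℝ))
    (hid : ∀ j j', root j ≠ root j' →
      ∑ i, (Y (root j') ^ p i - Y (root j) ^ p i) * (w j i * w j' i) = (Y (root j') - Y (root j)) * (q j ⬝ᵥ q j'))
    (hdown : ∀ (t : Fin T) (c : J → ℝ),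
      ∑ i, p i * Y t ^ (p i - 1) * ((∑ j ∈ univ.filter (fun j => root j = t), c j • w j) i) ^ 2
        ≤ (∑ j ∈ univ.filter (fun j => root j = t), c j • q j) ⬝ᵥ
          (∑ j ∈ univ.filter (fun j => root j = t), c j • q j))
    (hli : ∀ c : J → ℝ, (∀ t, ∑ j ∈ univ.filter (fun j => root j = t), c j • w j = 0) →
      (∀ t, ∑ j ∈ univ.filter (fun j => root j = t), c j • q j = 0) → c = 0) :
    Fintype.card J ≤ m := by
  classical
  by_contra hlt
  push Not at hlt
  -- a dependency among the fast components
  let f : (J → ℝ) →ₗ[ℝ] (Fin m → ℝ) :=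
    { toFun := fun d => ∑ j, d j • q j
      map_add' := by
        intro d d'
        simp only [Pi.add_apply, add_smul, Finset.sum_add_distrib]
      map_smul' := by
        intro r d
        simp only [Pi.smul_apply, smul_eq_mul, mul_smul, ← Finset.smul_sum, RingHom.id_apply] }
  have hker : LinearMap.ker f ≠ ⊥ := by
    apply LinearMap.ker_ne_bot_of_finrank_lt
    rw [Module.finrank_fintype_fun_eq_card, Module.finrank_fintype_fun_eq_card, Fintype.card_fin]
    exact hlt
  obtain ⟨c, hcker, hc0⟩ := (Submodule.ne_bot_iff _).mp hker
  have hsumq : ∑ j, c j • q j = 0 := LinearMap.mem_ker.mp hcker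
  -- per-node aggregates
  set W : Fin T → (Fin n → ℝ) := fun t => ∑ j ∈ univ.filter (fun j => root j = t), c j • w j with hWdef
  set Q : Fin T → (Fin m → ℝ) := fun t => ∑ j ∈ univ.filter (fun j => root j = t), c j • q j with hQdef
  have hQsum : ∑ t, Q t = 0 := by
    simp only [hQdef]
    rw [Finset.sum_fiberwise univ root (fun j => c j • q j)]
    exact hsumq
  -- coordinatewise two-point identities for the aggregates
  have hidW : ∀ t t', t ≠ t' → ∑ i, (Y t' ^ p i - Y t ^ p i) * (W t i * W t' i) = (Y t' - Y t) * (Q t ⬝ᵥ Q t') := by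
    intro t t' htt'
    -- expand both sides bilinearly over the two fibres
    have hL : ∑ i, (Y t' ^ p i - Y t ^ p i) * (W t i * W t' i)
        = ∑ j ∈ univ.filter (fun j => root j = t), ∑ j' ∈ univ.filter (fun j => root j = t'),
            c j * c j' * ∑ i, (Y t' ^ p i - Y t ^ p i) * (w j i * w j' i) := by
      simp only [hWdef, Finset.sum_apply, Pi.smul_apply, smul_eq_mul]
      -- Σ_i a_i (Σ_j c_j w_j i)(Σ_j' c_j' w_j' i) = Σ_j Σ_j' c c' Σ_i a_i w w'
      calc ∑ i, (Y t' ^ p i - Y t ^ p i) *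
              ((∑ j ∈ univ.filter (fun j => root j = t), c j * w j i) * ∑ j' ∈ univ.filter (fun j => root j = t'), c j' * w j' i)
          = ∑ i, ∑ j ∈ univ.filter (fun j => root j = t), ∑ j' ∈ univ.filter (fun j => root j = t'),
              c j * c j' * ((Y t' ^ p i - Y t ^ p i) * (w j i * w j' i)) := by
            refine Finset.sum_congr rfl fun i _ => ?_
            rw [Finset.sum_mul_sum, Finset.mul_sum]
            refine Finset.sum_congr rfl fun j _ => ?_
            rw [Finset.mul_sum]
            refine Finset.sum_congr rfl fun j' _ => ?_
            ring
        _ = ∑ j ∈ univ.filter (fun j => root j = t), ∑ j' ∈ univ.filter (fun j => root j = t'),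
              c j * c j' * ∑ i, (Y t' ^ p i - Y t ^ p i) * (w j i * w j' i) := by
            rw [Finset.sum_comm]
            refine Finset.sum_congr rfl fun j _ => ?_
            rw [Finset.sum_comm]
            refine Finset.sum_congr rfl fun j' _ => ?_
            rw [Finset.mul_sum]
    have hR : (Y t' - Y t) * (Q t ⬝ᵥ Q t')
        = ∑ j ∈ univ.filter (fun j => root j = t), ∑ j' ∈ univ.filter (fun j => root j = t'),
            c j * c j' * ((Y t' - Y t) * (q j ⬝ᵥ q j')) := by
      simp only [hQdef]
      rw [sum_dotProduct, Finset.mul_sum]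
      refine Finset.sum_congr rfl fun j _ => ?_
      rw [dotProduct_sum, Finset.mul_sum]
      refine Finset.sum_congr rfl fun j' _ => ?_
      rw [smul_dotProduct, dotProduct_smul, smul_eq_mul, smul_eq_mul]
      ring
    rw [hL, hR]
    refine Finset.sum_congr rfl fun j hj => Finset.sum_congr rfl fun j' hj' => ?_
    have hrj : root j = t := (Finset.mem_filter.mp hj).2
    have hrj' : root j' = t' := (Finset.mem_filter.mp hj').2
    have hne : root j ≠ root j' := by rw [hrj, hrj']; exact htt'
    have h := hid j j' hne
    rw [hrj, hrj'] at h
    rw [h]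
  have hdownW : ∀ t, ∑ i, p i * Y t ^ (p i - 1) * (W t i) ^ 2 ≤ Q t ⬝ᵥ Q t := fun t => hdown t c
  -- the normalised Loewner kernels, one per coordinate
  set c₀ : Fin n → ℝ := fun i => ∫ x in Ioi 0, rpowIntegrand₀₁ (p i) x 1 with hc₀def
  have hc₀ : ∀ i, 0 < c₀ i := fun i => integral_rpowIntegrand₀₁_one_pos (hp i)
  set L : Fin n → Fin T → Fin T → ℝ :=
    fun i t t' => (c₀ i)⁻¹ * ∫ x in Ioi 0, x ^ p i / ((x + Y t) * (x + Y t')) with hLdef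
  have hLdiag : ∀ i t, L i t t = p i * Y t ^ (p i - 1) := by
    intro i t
    simp only [hLdef]
    rw [integral_kernel_diag (p i) (Y t) (hp i) (hY t), ← mul_assoc, inv_mul_cancel₀ (ne_of_gt (hc₀ i)), one_mul]
  have hLoffi : ∀ i t t', L i t t' * (Y t - Y t') = Y t ^ p i - Y t' ^ p i := by
    intro i t t'
    simp only [hLdef]
    rw [mul_assoc, integral_kernel_mul_sub (p i) (Y t) (Y t') (hp i) (hY t) (hY t'), ← mul_assoc,
      inv_mul_cancel₀ (ne_of_gt (hc₀ i)), one_mul]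
  have hLoff : ∀ t t', t ≠ t' → Q t ⬝ᵥ Q t' = ∑ i, L i t t' * (W t i * W t' i) := by
    intro t t' htt'
    have hne : Y t - Y t' ≠ 0 := sub_ne_zero.mpr (fun h => htt' (hinj h))
    have h := hidW t t' htt'
    have h2 : (Y t - Y t') * (Q t ⬝ᵥ Q t') = (Y t - Y t') * ∑ i, L i t t' * (W t i * W t' i) := by
      have : (Y t - Y t') * (Q t ⬝ᵥ Q t') = ∑ i, (Y t ^ p i - Y t' ^ p i) * (W t i * W t' i) := by
        rw [show ∑ i, (Y t ^ p i - Y t' ^ p i) * (W t i * W t' i) = -∑ i, (Y t' ^ p i - Y t ^ p i) * (W t i * W t' i) by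
          rw [← Finset.sum_neg_distrib]; refine Finset.sum_congr rfl fun i _ => ?_; ring]
        rw [h]; ring
      rw [this, Finset.mul_sum]
      refine Finset.sum_congr rfl fun i _ => ?_
      rw [← hLoffi i t t']; ring
    exact mul_left_cancel₀ hne h2
  have hLpos : ∀ i (x : Fin T → ℝ), x ≠ 0 → 0 < ∑ t, ∑ t', x t * L i t t' * x t' := by
    intro i x hx
    have h := loewnerForm_pos (p i) (hp i) Y x hY hinj hx
    have heq : ∑ t, ∑ t', x t * L i t t' * x t'
        = (c₀ i)⁻¹ * ∑ t, ∑ t', x t * (∫ s in Ioi 0, s ^ p i / ((s + Y t) * (s + Y t'))) * x t' := by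
      rw [Finset.mul_sum]
      refine Finset.sum_congr rfl fun t _ => ?_
      rw [Finset.mul_sum]
      refine Finset.sum_congr rfl fun t' _ => ?_
      simp only [hLdef]; ring
    rw [heq]
    exact mul_pos (inv_pos.mpr (hc₀ i)) h
  have hLnn : ∀ i (x : Fin T → ℝ), 0 ≤ ∑ t, ∑ t', x t * L i t t' * x t' := by
    intro i x
    by_cases hx : x = 0
    · subst hx; simp
    · exact le_of_lt (hLpos i x hx)
  -- expand 0 = ‖Σ_t Q_t‖²
  have hzero : (∑ t, Q t) ⬝ᵥ (∑ t', Q t') = 0 := by rw [hQsum, dotProduct_zero]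
  have hexp : (∑ t, Q t) ⬝ᵥ (∑ t', Q t') = ∑ t, ∑ t', Q t ⬝ᵥ Q t' := by
    rw [sum_dotProduct]
    refine Finset.sum_congr rfl fun t _ => ?_
    rw [dotProduct_sum]
  have hterm : ∀ t t', Q t ⬝ᵥ Q t' =
      (∑ i, W t i * L i t t' * W t' i)
        + (if t = t' then (Q t ⬝ᵥ Q t - ∑ i, p i * Y t ^ (p i - 1) * (W t i) ^ 2) else 0) := by
    intro t t'
    by_cases htt' : t = t'
    · subst htt'
      rw [if_pos rfl]
      have : ∑ i, W t i * L i t t * W t i = ∑ i, p i * Y t ^ (p i - 1) * (W t i) ^ 2 := by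
        refine Finset.sum_congr rfl fun i _ => ?_
        rw [hLdiag]; ring
      rw [this]; ring
    · rw [if_neg htt', add_zero, hLoff t t' htt']
      refine Finset.sum_congr rfl fun i _ => ?_
      ring
  have hdouble : ∑ t, ∑ t', Q t ⬝ᵥ Q t' =
      (∑ t, ∑ t', ∑ i, W t i * L i t t' * W t' i)
        + ∑ t, (Q t ⬝ᵥ Q t - ∑ i, p i * Y t ^ (p i - 1) * (W t i) ^ 2) := by
    rw [Finset.sum_congr rfl fun t _ => Finset.sum_congr rfl fun t' _ => hterm t t']
    rw [← Finset.sum_add_distrib]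
    refine Finset.sum_congr rfl fun t _ => ?_
    rw [Finset.sum_add_distrib, Finset.sum_ite_eq, if_pos (Finset.mem_univ _)]
  have hcomm : ∑ t, ∑ t', ∑ i, W t i * L i t t' * W t' i = ∑ i, ∑ t, ∑ t', W t i * L i t t' * W t' i := by
    calc (∑ t, ∑ t', ∑ i, W t i * L i t t' * W t' i)
        = ∑ t, ∑ i, ∑ t', W t i * L i t t' * W t' i := Finset.sum_congr rfl fun t _ => Finset.sum_comm
      _ = ∑ i, ∑ t, ∑ t', W t i * L i t t' * W t' i := Finset.sum_comm
  have hKi : ∀ i, 0 ≤ ∑ t, ∑ t', W t i * L i t t' * W t' i := fun i => hLnn i (fun t => W t i)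
  have hA : 0 ≤ ∑ t, ∑ t', ∑ i, W t i * L i t t' * W t' i := by
    rw [hcomm]; exact Finset.sum_nonneg fun i _ => hKi i
  have hexcess : ∀ t, 0 ≤ Q t ⬝ᵥ Q t - ∑ i, p i * Y t ^ (p i - 1) * (W t i) ^ 2 := fun t => by linarith [hdownW t]
  have hB : 0 ≤ ∑ t, (Q t ⬝ᵥ Q t - ∑ i, p i * Y t ^ (p i - 1) * (W t i) ^ 2) := Finset.sum_nonneg fun t _ => hexcess t
  rw [hexp, hdouble] at hzero
  have hA0 : ∑ t, ∑ t', ∑ i, W t i * L i t t' * W t' i = 0 := by linarith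
  have hB0 : ∑ t, (Q t ⬝ᵥ Q t - ∑ i, p i * Y t ^ (p i - 1) * (W t i) ^ 2) = 0 := by linarith
  -- every aggregate W_t vanishes (coordinate by coordinate)
  have hW0 : ∀ t, W t = 0 := by
    intro t
    funext i
    rw [hcomm] at hA0
    have hi0 := (Finset.sum_eq_zero_iff_of_nonneg fun i _ => hKi i).mp hA0 i (Finset.mem_univ _)
    by_contra hne
    have hci : (fun t => W t i) ≠ 0 := fun h => hne (congrFun h t)
    have := hLpos i (fun t => W t i) hci
    linarith
  -- then every aggregate Q_t vanishes
  have hQ0 : ∀ t, Q t = 0 := by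
    intro t
    have hBt := (Finset.sum_eq_zero_iff_of_nonneg fun t _ => hexcess t).mp hB0 t (Finset.mem_univ _)
    have hWs : ∑ i, p i * Y t ^ (p i - 1) * (W t i) ^ 2 = 0 := by
      refine Finset.sum_eq_zero fun i _ => ?_
      rw [hW0 t]; simp
    rw [hWs, sub_zero] at hBt
    exact dotProduct_self_eq_zero.mp hBt
  exact hc0 (hli c (fun t => hW0 t) (fun t => hQ0 t))

end MixedGauge

end Summit.ValiantsHypothesis.ValiantsHypothesis.Theorems.KPlusLogSqLaw
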